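import Literature.NumberTheory.EllipticCurves.MordellWeilModNCard
import HarnessLib

/-!
# The index of `f(A)` for an endomorphism `f` with `f ∘ f = −p` of a finitely generated abelian group

Pure algebra serving the `√−3`-descent on the Mordell curves `y² = x³ + B²` over `ℚ(√−3)`
(sequel files `MordellCurveSqrtThree*.lean`; Silverman, *AEC* X.4 for descent by an isogeny, in
particular Remark X.4.7 relating `#E'(K)/φE(K)`, `#E(K)/φ̂E'(K)` and `#E(K)/mE(K)`): if `f : A → A` is an endomorphism of a finitely
generated abelian group with `f(f(a)) = −p·a` (`p ≥ 1`; the complex multiplication `[√−p]` on the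
Mordell–Weil group over a field containing `√−p` is the case in point), then

  `[A : f(A)]² = p^{rank_ℤ A} · #ker(f)²`     (`index_range_sq_of_comp_self`),

and (`…_of_card_ker`) if
`#ker f = p` then `[A : f(A)] = p^{rank_ℤ A / 2 + 1}` and `rank_ℤ A` is even. Proof (indices
throughout, no structure theory beyond `#(A/pA) = p^{rank} #A[p]`, tree
`natCard_quotient_nsmulRange_eq`): `pA = f(fA) ≤ fA ≤ A`, `[fA : pA] = [A : fA + ker f]`
(`a ↦ f(a) mod f(fA)`), `[fA + ker f : fA] = [ker f : ker f ∩ fA]`, and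
`ker f ∩ fA = f(A[p])` with `#f(A[p]) · #ker f = #A[p]` (`ker f ⊆ A[p]`).

## References

* J. H. Silverman, *The Arithmetic of Elliptic Curves*, 2nd ed., GTM 106 (2009), X.4 (descent via
  an isogeny; Remark X.4.7: the exact sequence relating `E'(K)/φE(K)`, `E(K)/φ̂E'(K)` and
  `E(K)/mE(K)`). [SilvermanAEC2009]
-/

namespace Literature.NumberTheory.EllipticCurves

variable {A : Type*} [AddCommGroup A]

/-- `f(fA) = pA` when `f ∘ f = −p`. [folklore] -/
theorem map_range_eq_nsmulRange (f : A →+ A) (p : ℕ) (hf : ∀ a, f (f a) = -(p • a)) :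
    f.range.map f = (nsmulAddMonoidHom p : A →+ A).range := by
  ext x
  simp only [AddSubgroup.mem_map, AddMonoidHom.mem_range, nsmulAddMonoidHom_apply]
  constructor
  · rintro ⟨y, ⟨a, rfl⟩, rfl⟩
    exact ⟨-a, by rw [hf, smul_neg]⟩
  · rintro ⟨a, rfl⟩
    exact ⟨f (-a), ⟨-a, rfl⟩, by rw [hf, smul_neg, neg_neg]⟩

/-- `ker f ∩ fA = f(A[p])` when `f ∘ f = −p`. [folklore] -/
theorem range_inf_ker_eq_map_torsionBy (f : A →+ A) (p : ℕ) (hf : ∀ a, f (f a) = -(p • a)) :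
    f.range ⊓ f.ker = (AddSubgroup.torsionBy A (p : ℤ)).map f := by
  ext x
  simp only [AddSubgroup.mem_inf, AddMonoidHom.mem_range, AddMonoidHom.mem_ker, AddSubgroup.mem_map,
    AddSubgroup.torsionBy.nsmul_iff]
  constructor
  · rintro ⟨⟨a, rfl⟩, hx⟩
    refine ⟨a, ?_, rfl⟩
    have := hf a
    rw [hx] at this
    exact neg_eq_zero.mp this.symm
  · rintro ⟨a, ha, rfl⟩
    exact ⟨⟨a, rfl⟩, by rw [hf, ha, neg_zero]⟩

/-- `ker f ⊆ A[p]` when `f ∘ f = −p`. [folklore] -/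
theorem ker_le_torsionBy (f : A →+ A) (p : ℕ) (hf : ∀ a, f (f a) = -(p • a)) :
    f.ker ≤ AddSubgroup.torsionBy A (p : ℤ) := by
  intro a ha
  rw [AddMonoidHom.mem_ker] at ha
  rw [AddSubgroup.torsionBy.nsmul_iff]
  have := hf a
  rw [ha, map_zero] at this
  exact neg_eq_zero.mp this.symm

/-- `#K = #(H ⊓ K) · [K : H ⊓ K]` (`H.relIndex K = [K : H ⊓ K]`). [folklore] -/
theorem card_inf_mul_relIndex (H K : AddSubgroup A) :
    Nat.card (H ⊓ K : AddSubgroup A) * H.relIndex K = Nat.card K := by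
  rw [← AddSubgroup.inf_relIndex_right H K, AddSubgroup.relIndex,
    ← Nat.card_congr (AddSubgroup.addSubgroupOfEquivOfLe (inf_le_right : H ⊓ K ≤ K)).toEquiv]
  exact AddSubgroup.card_mul_index _

/-- `[fA : f(fA)] = [A : fA + ker f]` (the surjection `a ↦ f(a) mod f(fA)`). [folklore] -/
theorem relIndex_map_range (f : A →+ A) :
    (f.range.map f).relIndex f.range = (f.range ⊔ f.ker).index := by
  rw [← AddSubgroup.comap_map_eq f f.range, ← AddSubgroup.relIndex_top_right,
    AddSubgroup.relIndex_comap, ← AddMonoidHom.range_eq_map]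

/-- **`[A : f(A)]² = p^{rank_ℤ A} · #ker(f)²`** for an endomorphism `f` of a finitely generated
abelian group `A` with `f ∘ f = −p`, `p ≥ 1`. [cite: SilvermanAEC2009, X.4 Remark X.4.7] -/
theorem index_range_sq_of_comp_self [Module.Finite ℤ A] (f : A →+ A) (p : ℕ)
    [NeZero p] (hf : ∀ a, f (f a) = -(p • a)) :
    f.range.index ^ 2 = p ^ Module.finrank ℤ A * Nat.card f.ker ^ 2 := by
  set R := f.range with hR
  set K := f.ker with hK
  set P := (nsmulAddMonoidHom p : A →+ A).range with hP
  set Tp := AddSubgroup.torsionBy A (p : ℤ) with hTp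
  haveI : Finite Tp := finite_torsionBy_of_moduleFinite A p
  have hKle : K ≤ Tp := ker_le_torsionBy f p hf
  haveI : Finite K := Finite.of_injective (AddSubgroup.inclusion hKle) (AddSubgroup.inclusion_injective hKle)
  -- (a) `P = f(R) ≤ R` and `[A : P] = [R ⊔ K... ] `
  have hPR : P = R.map f := (map_range_eq_nsmulRange f p hf).symm
  have hPle : P ≤ R := by rw [hPR]; exact AddSubgroup.map_le_range f R
  have ha : P.relIndex R * R.index = P.index := AddSubgroup.relIndex_mul_index hPle
  have hb : P.relIndex R = (R ⊔ K).index := by rw [hPR]; exact relIndex_map_range f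
  -- (b) `[A : R] = [A : R ⊔ K] [K : R ⊓ K]`
  have hc : R.relIndex (R ⊔ K) * (R ⊔ K).index = R.index := AddSubgroup.relIndex_mul_index le_sup_left
  have hd : R.relIndex (R ⊔ K) = R.relIndex K := AddSubgroup.relIndex_sup_left K R
  -- (c) `#K = #(R ⊓ K) [K : R ⊓ K]` and `#(R ⊓ K) #K = #Tp`
  have he : Nat.card (R ⊓ K : AddSubgroup A) * R.relIndex K = Nat.card K := card_inf_mul_relIndex R K
  have hf' : R ⊓ K = Tp.map f := range_inf_ker_eq_map_torsionBy f p hf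
  have hg : Nat.card (K ⊓ Tp : AddSubgroup A) * K.relIndex Tp = Nat.card Tp := card_inf_mul_relIndex K Tp
  have hg' : K.relIndex Tp = Nat.card (Tp.map f) := AddSubgroup.relIndex_ker (K := Tp) f
  have hg'' : K ⊓ Tp = K := inf_eq_left.mpr hKle
  -- (d) `[A : P] = p^n #Tp`
  have hh : P.index = p ^ Module.finrank ℤ A * Nat.card Tp := by
    rw [AddSubgroup.index_eq_card]; exact natCard_quotient_nsmulRange_eq A p
  -- assemble
  rw [hg'', hg', ← hf'] at hg
  rw [hb] at ha
  rw [hd] at hc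
  have hK0 : 0 < Nat.card K := Nat.card_pos
  set x := R.index
  set y := (R ⊔ K).index
  set z := R.relIndex K
  set k := Nat.card K
  set m := Nat.card (R ⊓ K : AddSubgroup A)
  set t := Nat.card Tp
  set n := Module.finrank ℤ A
  -- `y x = p^n t`, `z y = x`, `m z = k`, `k m = t`
  have h1 : y * x = p ^ n * t := ha.trans hh
  have key : x ^ 2 * m = p ^ n * k ^ 2 * m := by
    calc x ^ 2 * m = x * (z * y) * m := by rw [hc, sq]
      _ = (y * x) * (m * z) := by ring
      _ = p ^ n * t * k := by rw [h1, he]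
      _ = p ^ n * (k * m) * k := by rw [hg]
      _ = p ^ n * k ^ 2 * m := by ring
  haveI : Finite (R ⊓ K : AddSubgroup A) :=
    Finite.of_injective (AddSubgroup.inclusion (inf_le_right : R ⊓ K ≤ K))
      (AddSubgroup.inclusion_injective _)
  have hm0 : 0 < m := Nat.card_pos
  exact Nat.eq_of_mul_eq_mul_right hm0 key

/-- **`[A : f(A)] = p^{rank_ℤ A/2 + 1}` and `rank_ℤ A` is even** when moreover `#ker f = p` is a
prime (e.g. `f = [√−3]` on `E(K)` for `K ∋ √−3`, `ker f = E[√−3](K)` of order `3`).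
[cite: SilvermanAEC2009, X.4 Remark X.4.7] -/
theorem index_range_of_comp_self_of_card_ker [Module.Finite ℤ A] (f : A →+ A)
    {p : ℕ} (hp : p.Prime) (hf : ∀ a, f (f a) = -(p • a)) (hker : Nat.card f.ker = p) :
    Even (Module.finrank ℤ A) ∧ f.range.index = p ^ (Module.finrank ℤ A / 2 + 1) := by
  haveI : NeZero p := ⟨hp.ne_zero⟩
  have h := index_range_sq_of_comp_self f p hf
  rw [hker, ← pow_add] at h
  -- `x² = p^(n+2)` forces `n` even and `x = p^(n/2+1)`
  set n := Module.finrank ℤ A with hn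
  set x := f.range.index with hx
  have hpx : ∀ q : ℕ, q.Prime → q ∣ x → q = p := fun q hq hqx ↦ by
    have : q ∣ p ^ (n + 2) := by rw [← h]; exact dvd_pow hqx two_ne_zero
    exact (Nat.prime_dvd_prime_iff_eq hq hp).mp (hq.dvd_of_dvd_pow this)
  have hx0 : x ≠ 0 := fun h0 ↦ by
    rw [h0, zero_pow two_ne_zero] at h
    exact pow_ne_zero _ hp.ne_zero h.symm
  -- `x` is a power of `p`
  obtain ⟨k, hk⟩ : ∃ k, x = p ^ k := by
    refine ⟨x.factorization p, ?_⟩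
    refine (Nat.eq_pow_of_factorization_eq_single hx0 ?_)
    ext q
    by_cases hq : q = p
    · subst hq; simp
    · rw [Finsupp.single_eq_of_ne hq]
      by_contra hne
      have hqprime : q.Prime := Nat.prime_of_mem_primeFactors
        (Nat.support_factorization x ▸ Finsupp.mem_support_iff.mpr hne)
      exact hq (hpx q hqprime (Nat.dvd_of_mem_primeFactors
        (Nat.support_factorization x ▸ Finsupp.mem_support_iff.mpr hne)))
  rw [hk, ← pow_mul] at h
  have hexp : k * 2 = n + 2 := Nat.pow_right_injective hp.two_le h
  refine ⟨⟨k - 1, by omega⟩, ?_⟩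
  rw [hk]
  congr 1
  omega

end Literature.NumberTheory.EllipticCurves
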